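import Literature.AlgebraicGeometry.Surfaces.K3HodgeTypes
import Literature.AlgebraicGeometry.Surfaces.K3Marking
import Literature.AlgebraicGeometry.HodgeTheory.HodgeTypeConjugation
import Literature.AlgebraicGeometry.HodgeTheory.ComplexGysinHodgeType
import Literature.AlgebraicGeometry.HodgeTheory.CupPreservesHodgeTypeOfDeRham
import Literature.AlgebraicTopology.SingularHomology.CupProductProofs
import HarnessLib

/-!
# The Hodge types on `H²` of a K3 surface — proofs: reduction of `Huybrechts_K3_hodgeTypes_H2`
# to `h^{2,0} ≤ 1`, the bigrading of the cup product and the Hodge–Riemann inequality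

Family `hodge`, layer `Literature/AlgebraicGeometry/Surfaces`. Companion (proof file) of
`K3HodgeTypes.lean`, whose named fact `Huybrechts_K3_hodgeTypes_H2` renders Huybrechts, *Lectures
on K3 Surfaces*, Ch. 1 (2.7) and Ch. 6 Prop. 1.2 / Ex. 1.3 (i): for a projective K3 surface `S` and
a non-zero `(2,0)`-class `σ`, the `(2,0)`-classes are `ℂσ`, the `(0,2)`-classes are `ℂσ̄` and the
`(1,1)`-classes are `σ^⊥ ∩ σ̄^⊥` (cup product into `H⁴`).

PROVED here (no named fact introduced):

* `isOfHodgeType_swap_iff_of_line` — for ANY smooth projective `X`: if the `(p,q)`-classes of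
  `Hᵏ(X(ℂ); ℂ)` are the multiples of `σ`, the `(q,p)`-classes are the multiples of `σ̄`
  (`\overline{H^{p,q}} = H^{q,p}`, Voisin I Cor. 6.12, through the tree's unconditional
  `HodgeTheory.IsOfHodgeType.conjClass`). Hence **the `(0,2)`-clause of the fact follows from its
  `(2,0)`-clause** (Huybrechts Ch. 3 Def. 1.1: `V^{0,2} = \overline{V^{2,0}}`).
* `IsK3Surface.isOfHodgeType_oneOne_iff` — **the `(1,1)`-clause** (Ch. 6 Prop. 1.2 (iii) and its
  proof "`Λ^{1,1}` is the complexification of the orthogonal complement of `⟨Re σ, Im σ⟩`"), GIVEN: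
  the `(2,0)`-line `H^{2,0} = ℂσ`, the bigrading of the cup product on `S`
  (`HodgeTheory.CupPreservesHodgeType 2 S`, Voisin I Thm. 5.29 / §7.1.2 — a theorem of the tree
  from de Rham's theorem in multiplicative form, `cupPreservesHodgeType_of_exists_deRhamIsoFamily`)
  and the Hodge–Riemann inequality `(σ̄.σ) ≠ 0` (Prop. 1.2 (ii)). Proof: `⊆` — a `(1,1)`-class cups
  with `σ` (resp. `σ̄`) to a class of type `(3,1)` (resp. `(1,3)`) in `H⁴`, which is zero
  (`HodgeTheory.cupProduct_eq_zero_of_hodgeType`, "the forms of degree `4` are of bidegree `(2,2)`");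
  `⊇` — decompose `c = aσ + c₁₁ + bσ̄` (Hodge decomposition of the model,
  `HodgeModel.exists_sum_eq_of_hodgeDecomposition`, and the two lines), then
  `c.σ = b(σ̄.σ)` and `c.σ̄ = a(σ.σ̄) = a(σ̄.σ)` (types again, and graded commutativity
  `cupProduct_gradedComm_holds`), so `a = b = 0`.
* `Huybrechts_K3_hodgeTypes_H2_of_cupPreservesHodgeType` — the fact from three inputs stated for
  all K3 surfaces: `h^{2,0} ≤ 1` (the hypothesis `hT` of `Huybrechts_K3_marking_exists.of_facts`,
  Ch. 1 (2.7)), `CupPreservesHodgeType 2 S`, and `(σ̄.σ) ≠ 0`;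
  `Huybrechts_K3_hodgeTypes_H2_of_exists_deRhamIsoFamily` — the same with the bigrading supplied by
  de Rham's theorem `Literature.NumberTheory.Transcendental.exists_deRhamIsoFamily` (named fact);
* `Huybrechts_K3_hodgeTypes_H2_of_marking` — **the fact from `Huybrechts_K3_marking_exists` and the
  bigrading alone**: a marking supplies the `(2,0)`-line (its clause "every `(2,0)`-class is a
  multiple of `η⁻¹x`") and the Hodge–Riemann inequality (`σ̄.σ = (x̄.x) p ≠ 0`, markings being
  real: `conjClass_markingSymm`, the basis `η⁻¹(eⱼ)` consists of integral classes).

Consequence recorded downstream (`Summits/HodgeConjecture/.../NikulinTwinTransportTwinExists`): the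
route item `TwinExists` is conditional on `Huybrechts_K3_marking_exists`,
`Huybrechts_K3_periodSurjective_projective` and the bigrading / de Rham's theorem, the K3-specific
fact `Huybrechts_K3_hodgeTypes_H2` being no longer needed as a separate input. What is NOT here:
`h^{2,0} ≤ 1` itself (holomorphic `2`-forms on `S^an` are `f·η`, `f` constant — needs the
`∂̄`-calculus of `(2,0)`-forms), the Hodge–Riemann inequality from integration, and de Rham's
theorem in multiplicative form.

## References

* [Huybrechts2016K3] D. Huybrechts, Lectures on K3 Surfaces, CUP 2016: Ch. 1 §2.4 (2.7); Ch. 3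
  Def. 1.1; Ch. 6 §1.1 Prop. 1.2 (i)–(iii) with its proof, Example 1.3 (i).
* [VoisinHodgeI2002] C. Voisin, Hodge Theory and Complex Algebraic Geometry I, CUP 2002, Cor. 6.12,
  Cor. 6.14, Thm. 5.29, §7.1.2, Lemma 7.30.
-/

noncomputable section

open scoped Manifold ContDiff
open CategoryTheory
open Literature.AlgebraicTopology.SingularHomology
open Literature.AlgebraicGeometry.HodgeTheory
open Literature.NumberTheory.Transcendental (exists_deRhamIsoFamily)

namespace Literature.AlgebraicGeometry.Surfaces

/-! ### `\overline{H^{p,q}} = H^{q,p}` for lines -/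

/-- **If the `(p,q)`-classes form the line `ℂσ`, the `(q,p)`-classes form the line `ℂσ̄`** (for
`X` smooth projective; `\overline{H^{p,q}} = H^{q,p}`, Voisin I Cor. 6.12, and `conj` is
conjugate-linear). For a K3 surface: `H^{0,2} = ℂσ̄` from `H^{2,0} = ℂσ` (Huybrechts Ch. 3
Def. 1.1, `V^{0,2} = \overline{V^{2,0}}`). [cite: VoisinHodgeI2002, Cor. 6.12]
[cite: Huybrechts2016K3, Ch. 3 Def. 1.1 and Ch. 1 (2.7)] -/
theorem isOfHodgeType_swap_iff_of_line {n : ℕ} {X : Motives.SchemeOver ℂ}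
    (hX : Motives.IsSmoothProjective n X) {k p q : ℕ} {σ : complexBetti X k}
    (h : ∀ c : complexBetti X k, IsOfHodgeType n X k p q c ↔ ∃ t : ℂ, c = t • σ)
    (c : complexBetti X k) :
    IsOfHodgeType n X k q p c ↔ ∃ t : ℂ, c = t • conjClass (Motives.ComplexPoints X) k σ := by
  have h1 : IsOfHodgeType n X k q p c ↔
      IsOfHodgeType n X k p q (conjClass (Motives.ComplexPoints X) k c) := by
    simpa only [conjClass_conjClass] using
      (isOfHodgeType_conjClass_iff hX (p := p) (q := q)
        (conjClass (Motives.ComplexPoints X) k c))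
  rw [h1, h]
  constructor
  · rintro ⟨t, ht⟩
    refine ⟨starRingEnd ℂ t, ?_⟩
    have h2 := congrArg (conjClass (Motives.ComplexPoints X) k) ht
    rwa [conjClass_conjClass, conjClass_smul] at h2
  · rintro ⟨t, rfl⟩
    exact ⟨starRingEnd ℂ t, by rw [conjClass_smul, conjClass_conjClass]⟩

/-! ### The `(1,1)`-classes of a K3 surface -/

variable {S : Motives.SchemeOver ℂ}

/-- Expansion of `∑_{(i,j), i+j=2}` into its three terms `(0,2), (1,1), (2,0)` (the antidiagonal of
`Finset.HasAntidiagonal`, as in `HodgeModel.exists_sum_eq_of_hodgeDecomposition`; the name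
`Finset.antidiagonal` is shadowed by the well-ordered variant under these imports). [folklore] -/
theorem sum_antidiagonal_two_mul_one {M : Type*} [AddCommMonoid M] (z : ℕ × ℕ → M) :
    ∑ i ∈ Finset.HasAntidiagonal.antidiagonal (2 * 1), z i = z (0, 2) + z (1, 1) + z (2, 0) := by
  rw [Finset.Nat.sum_antidiagonal_eq_sum_range_succ_mk]
  simp [Finset.sum_range_succ]

/-- **The `(1,1)`-classes of a K3 surface are `σ^⊥ ∩ σ̄^⊥`** (Huybrechts Ch. 6 Prop. 1.2 (iii)
and its proof), granted the `(2,0)`-line `H^{2,0} ⊆ ℂσ` (`h^{2,0} ≤ 1`), the bigrading of the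
cup product on `S` (`CupPreservesHodgeType 2 S`) and the Hodge–Riemann inequality `(σ̄.σ) ≠ 0`:
a class `c ∈ H²(S(ℂ); ℂ)` is of type `(1,1)` iff `c ∪ σ = 0` and `c ∪ σ̄ = 0`. `⟹`: the products
are of types `(3,1)`, `(1,3)` in `H⁴`, hence zero (`cupProduct_eq_zero_of_hodgeType`). `⟸`: write
`c = aσ + c₁₁ + bσ̄` (Hodge decomposition of a model and the two lines); then `c ∪ σ = b(σ̄ ∪ σ)`
and `c ∪ σ̄ = a(σ ∪ σ̄) = a(σ̄ ∪ σ)`, so `a = b = 0`. [cite: Huybrechts2016K3, Ch. 6 Prop. 1.2 (iii) and its proof]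
[cite: VoisinHodgeI2002, Lemma 7.30 and Cor. 6.14] -/
theorem IsK3Surface.isOfHodgeType_oneOne_iff (hS : IsK3Surface S) (hcup : CupPreservesHodgeType 2 S)
    {σ : complexBetti S (2 * 1)} (hσ : IsOfHodgeType 2 S (2 * 1) 2 0 σ)
    (h20 : ∀ c : complexBetti S (2 * 1), IsOfHodgeType 2 S (2 * 1) 2 0 c → ∃ t : ℂ, c = t • σ)
    (hHR : cupProduct (rfl : 2 * 1 + 2 * 1 = 2 * 2)
      (conjClass (Motives.ComplexPoints S) (2 * 1) σ) σ ≠ 0)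
    (c : complexBetti S (2 * 1)) :
    IsOfHodgeType 2 S (2 * 1) 1 1 c ↔
      cupProduct (rfl : 2 * 1 + 2 * 1 = 2 * 2) c σ = 0 ∧
        cupProduct (rfl : 2 * 1 + 2 * 1 = 2 * 2) c
          (conjClass (Motives.ComplexPoints S) (2 * 1) σ) = 0 := by
  have hX := hS.isSmoothProjective
  have hI := hodgePQ_independent_of_hodgeModel_holds
  obtain ⟨A⟩ := hS.nonempty_hodgeModel
  set σ' := conjClass (Motives.ComplexPoints S) (2 * 1) σ with hσ'_def
  have hσ' : IsOfHodgeType 2 S (2 * 1) 0 2 σ' := hσ.conjClass hX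
  -- products of non-complementary types vanish in `H⁴`
  have hvan : ∀ {p q p' q' : ℕ} (_ : ¬ (p + p' = 2 ∧ q + q' = 2)) {a b : complexBetti S (2 * 1)},
      IsOfHodgeType 2 S (2 * 1) p q a → IsOfHodgeType 2 S (2 * 1) p' q' b →
        cupProduct (rfl : 2 * 1 + 2 * 1 = 2 * 2) a b = 0 :=
    fun hne a b ha hb =>
      cupProduct_eq_zero_of_hodgeType hI hX A hcup rfl hne (ha.mem_hodgePQ hX A) (hb.mem_hodgePQ hX A)
  constructor
  · intro hc
    exact ⟨hvan (by omega) hc hσ, hvan (by omega) hc hσ'⟩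
  · rintro ⟨h1, h2⟩
    -- Hodge decomposition of `c` in the model `A`
    obtain ⟨z, hzc, hz⟩ := A.exists_sum_eq_of_hodgeDecomposition (2 * 1) c
    have hz' : ∀ i ∈ Finset.HasAntidiagonal.antidiagonal (2 * 1), IsOfHodgeType 2 S (2 * 1) i.1 i.2 (z i) :=
      fun i hi => ⟨A, hz i hi⟩
    have hz02 : IsOfHodgeType 2 S (2 * 1) 0 2 (z (0, 2)) := hz' (0, 2) (by simp)
    have hz11 : IsOfHodgeType 2 S (2 * 1) 1 1 (z (1, 1)) := hz' (1, 1) (by simp)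
    have hz20 : IsOfHodgeType 2 S (2 * 1) 2 0 (z (2, 0)) := hz' (2, 0) (by simp)
    rw [sum_antidiagonal_two_mul_one] at hzc
    -- the two lines
    obtain ⟨a, ha⟩ := h20 _ hz20
    have h02 : ∀ c : complexBetti S (2 * 1), IsOfHodgeType 2 S (2 * 1) 0 2 c → ∃ t : ℂ, c = t • σ' :=
      fun c hc => (isOfHodgeType_swap_iff_of_line hX (p := 2) (q := 0) (σ := σ)
        (fun c => ⟨h20 c, fun ⟨t, ht⟩ => ht ▸ hσ.smul t⟩) c).1 hc
    obtain ⟨b, hb⟩ := h02 _ hz02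
    -- graded commutativity in even degrees: `σ ∪ σ̄ = σ̄ ∪ σ`
    have hcomm : cupProduct (rfl : 2 * 1 + 2 * 1 = 2 * 2) σ σ' = cupProduct rfl σ' σ := by
      rw [cupProduct_gradedComm_holds ℂ (Motives.ComplexPoints S) rfl rfl σ σ']
      have h4 : ((-1 : ℂ) ^ (2 * 1 * (2 * 1))) = 1 := by norm_num
      rw [h4, one_smul]
    -- `c ∪ σ = b (σ̄ ∪ σ)`
    have hb0 : b = 0 := by
      have e1 : cupProduct (rfl : 2 * 1 + 2 * 1 = 2 * 2) c σ = b • cupProduct rfl σ' σ := by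
        rw [← hzc, hb, ha]
        simp only [map_add, map_smul, LinearMap.add_apply, LinearMap.smul_apply,
          hvan (by omega) hz11 hσ, hvan (by omega) hσ hσ, smul_zero, add_zero]
      rw [h1] at e1
      exact (smul_eq_zero.1 e1.symm).resolve_right hHR
    -- `c ∪ σ̄ = a (σ ∪ σ̄)`
    have ha0 : a = 0 := by
      have e2 : cupProduct (rfl : 2 * 1 + 2 * 1 = 2 * 2) c σ' = a • cupProduct rfl σ σ' := by
        rw [← hzc, hb, ha]
        simp only [map_add, map_smul, LinearMap.add_apply, LinearMap.smul_apply,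
          hvan (by omega) hz11 hσ', hvan (by omega) hσ' hσ', smul_zero, zero_add]
      rw [h2, hcomm] at e2
      exact (smul_eq_zero.1 e2.symm).resolve_right hHR
    have hc : c = z (1, 1) := by
      rw [← hzc, hb, ha, hb0, ha0]
      simp
    rw [hc]
    exact hz11

/-! ### The reductions of `Huybrechts_K3_hodgeTypes_H2` -/

/-- **`Huybrechts_K3_hodgeTypes_H2` from `h^{2,0} ≤ 1`, the bigrading of the cup product and the
Hodge–Riemann inequality** (conclusion = the named fact of `K3HodgeTypes.lean`). Inputs, for every
K3 surface `S` and every non-zero `(2,0)`-class `σ`: every `(2,0)`-class is a multiple of `σ`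
(Huybrechts Ch. 1 (2.7), `h^{2,0} = 1`; the hypothesis `hT` of
`Huybrechts_K3_marking_exists.of_facts`); `CupPreservesHodgeType 2 S` (Voisin I Thm. 5.29, §7.1.2);
`σ̄ ∪ σ ≠ 0` (Ch. 6 Prop. 1.2 (ii), `(σ.σ̄) > 0`). The `(0,2)`-clause is
`isOfHodgeType_swap_iff_of_line`, the `(1,1)`-clause `IsK3Surface.isOfHodgeType_oneOne_iff`.
[cite: Huybrechts2016K3, Ch. 1 (2.7); Ch. 6 Prop. 1.2 (ii), (iii)] [cite: VoisinHodgeI2002, Cor. 6.12 and Lemma 7.30] -/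
theorem Huybrechts_K3_hodgeTypes_H2_of_cupPreservesHodgeType
    (hT : ∀ (S : Motives.SchemeOver ℂ), IsK3Surface S →
      ∀ σ : complexBetti S (2 * 1), IsOfHodgeType 2 S (2 * 1) 2 0 σ → σ ≠ 0 →
        ∀ c : complexBetti S (2 * 1), IsOfHodgeType 2 S (2 * 1) 2 0 c → ∃ t : ℂ, c = t • σ)
    (hcup : ∀ (S : Motives.SchemeOver ℂ), IsK3Surface S → CupPreservesHodgeType 2 S)
    (hHR : ∀ (S : Motives.SchemeOver ℂ), IsK3Surface S →
      ∀ σ : complexBetti S (2 * 1), IsOfHodgeType 2 S (2 * 1) 2 0 σ → σ ≠ 0 →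
        cupProduct (rfl : 2 * 1 + 2 * 1 = 2 * 2) (conjClass (Motives.ComplexPoints S) (2 * 1) σ) σ ≠ 0) :
    Huybrechts_K3_hodgeTypes_H2 := by
  intro S hS σ hσ hσ0
  have h20 : ∀ c : complexBetti S (2 * 1), IsOfHodgeType 2 S (2 * 1) 2 0 c ↔ ∃ t : ℂ, c = t • σ :=
    fun c => ⟨hT S hS σ hσ hσ0 c, fun ⟨t, ht⟩ => ht ▸ hσ.smul t⟩
  exact ⟨h20, isOfHodgeType_swap_iff_of_line hS.isSmoothProjective h20,
    hS.isOfHodgeType_oneOne_iff (hcup S hS) hσ (fun c => (h20 c).1) (hHR S hS σ hσ hσ0)⟩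

/-- **The bigrading of the cup product on a K3 surface from de Rham's theorem** (multiplicative
form, on the model space of a Hodge model of `S`): `CupPreservesHodgeType 2 S`, by the tree's
`cupPreservesHodgeType_of_exists_deRhamIsoFamily` and the discharged independence of the model.
[cite: VoisinHodgeI2002, §5.3.2 Thm. 5.29 and §7.1.2] -/
theorem IsK3Surface.cupPreservesHodgeType_of_exists_deRhamIsoFamily (hS : IsK3Surface S)
    (hdR : ∀ (E : Type) [NormedAddCommGroup E] [NormedSpace ℂ E] [FiniteDimensional ℂ E],
      exists_deRhamIsoFamily 𝓘(ℝ, E)) :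
    CupPreservesHodgeType 2 S := by
  obtain ⟨A⟩ := hS.nonempty_hodgeModel
  exact HodgeTheory.cupPreservesHodgeType_of_exists_deRhamIsoFamily
    hodgePQ_independent_of_hodgeModel_holds hS.isSmoothProjective A (hdR A.model)

/-- **`Huybrechts_K3_hodgeTypes_H2` from `h^{2,0} ≤ 1`, de Rham's theorem and the Hodge–Riemann
inequality**: as `Huybrechts_K3_hodgeTypes_H2_of_cupPreservesHodgeType`, the bigrading being
supplied by the named fact `Literature.NumberTheory.Transcendental.exists_deRhamIsoFamily` (de Rham
1931; Warner Thm. 5.36 / 5.45) on every finite-dimensional complex model space.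
[cite: Huybrechts2016K3, Ch. 1 (2.7); Ch. 6 Prop. 1.2 (ii), (iii)] [cite: WarnerGTM94, Thm. 5.36 / Thm. 5.45] -/
theorem Huybrechts_K3_hodgeTypes_H2_of_exists_deRhamIsoFamily
    (hT : ∀ (S : Motives.SchemeOver ℂ), IsK3Surface S →
      ∀ σ : complexBetti S (2 * 1), IsOfHodgeType 2 S (2 * 1) 2 0 σ → σ ≠ 0 →
        ∀ c : complexBetti S (2 * 1), IsOfHodgeType 2 S (2 * 1) 2 0 c → ∃ t : ℂ, c = t • σ)
    (hdR : ∀ (E : Type) [NormedAddCommGroup E] [NormedSpace ℂ E] [FiniteDimensional ℂ E],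
      exists_deRhamIsoFamily 𝓘(ℝ, E))
    (hHR : ∀ (S : Motives.SchemeOver ℂ), IsK3Surface S →
      ∀ σ : complexBetti S (2 * 1), IsOfHodgeType 2 S (2 * 1) 2 0 σ → σ ≠ 0 →
        cupProduct (rfl : 2 * 1 + 2 * 1 = 2 * 2) (conjClass (Motives.ComplexPoints S) (2 * 1) σ) σ ≠ 0) :
    Huybrechts_K3_hodgeTypes_H2 :=
  Huybrechts_K3_hodgeTypes_H2_of_cupPreservesHodgeType hT
    (fun _ hS => hS.cupPreservesHodgeType_of_exists_deRhamIsoFamily hdR) hHR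

/-! ### From a marking: the `(2,0)`-line and the Hodge–Riemann inequality -/

/-- Expansion of a vector of `Λ_ℂ = ℂ²²` in the (integral) standard basis. [folklore] -/
theorem pi_eq_sum_intSingle (z : K3Index → ℂ) :
    z = ∑ j, z j • fun i => ((Pi.single j (1 : ℤ) : K3Index → ℤ) i : ℂ) := by
  classical
  funext i
  simp only [Finset.sum_apply, Pi.smul_apply, smul_eq_mul, Pi.single_apply, Int.cast_ite,
    Int.cast_one, Int.cast_zero, mul_ite, mul_one, mul_zero]
  rw [Finset.sum_ite_eq, if_pos (Finset.mem_univ i)]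

/-- The standard basis vectors of `Λ_ℂ` are real. [folklore] -/
theorem star_intSingle (j : K3Index) :
    star (fun i => ((Pi.single j (1 : ℤ) : K3Index → ℤ) i : ℂ)) =
      fun i => ((Pi.single j (1 : ℤ) : K3Index → ℤ) i : ℂ) := by
  funext i
  simp only [Pi.star_apply, star_intCast]

/-- **Markings are real**: under a marking `η : H²(S(ℂ); ℂ) ≅ Λ_ℂ` identifying the integral classes
with `Λ = ℤ²²`, complex conjugation of classes is complex conjugation of coordinates,
`conj (η⁻¹ z) = η⁻¹ z̄` — the basis `η⁻¹(eⱼ)` consists of integral, hence real, classes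
(`IsRationalClass.conjClass_eq`) and `conj` is conjugate-linear. [cite: VoisinHodgeI2002, Cor. 6.12]
[cite: Huybrechts2016K3, Ch. 1 Prop. 3.5] -/
theorem conjClass_markingSymm (η : complexBetti S (2 * 1) ≃ₗ[ℂ] (K3Index → ℂ))
    (hη : ∀ c : complexBetti S (2 * 1), IsIntegralClass c ↔ ∃ v : K3Index → ℤ, η c = fun i => (v i : ℂ))
    (z : K3Index → ℂ) :
    conjClass (Motives.ComplexPoints S) (2 * 1) (η.symm z) = η.symm (star z) := by
  classical
  have hint : ∀ j : K3Index,
      IsIntegralClass (η.symm fun i => ((Pi.single j (1 : ℤ) : K3Index → ℤ) i : ℂ)) := fun j =>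
    (hη _).2 ⟨Pi.single j 1, η.apply_symm_apply _⟩
  have hsz : star z = ∑ j, star (z j) • fun i => ((Pi.single j (1 : ℤ) : K3Index → ℤ) i : ℂ) := by
    conv_lhs => rw [pi_eq_sum_intSingle z]
    rw [star_sum]
    refine Finset.sum_congr rfl fun j _ => ?_
    rw [star_smul, star_intSingle]
  conv_lhs => rw [pi_eq_sum_intSingle z]
  rw [hsz, map_sum, map_sum, ← conjClassEquiv_apply, map_sum]
  refine Finset.sum_congr rfl fun j _ => ?_
  rw [conjClassEquiv_apply, map_smul, map_smul, conjClass_smul,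
    (hint j).isRationalClass.conjClass_eq, starRingEnd_apply]

/-- **A marking supplies the `(2,0)`-line**: if every `(2,0)`-class is a multiple of `σ₀ = η⁻¹x`
(clause of `Huybrechts_K3_marking_exists`), then for every non-zero `(2,0)`-class `σ` every
`(2,0)`-class is a multiple of `σ` (`σ = sσ₀`, `s ≠ 0`). [cite: Huybrechts2016K3, Ch. 1 (2.7) and Ch. 3 Def. 2.3] -/
theorem twoZero_line_of_span {σ₀ σ : complexBetti S (2 * 1)}
    (hspan : ∀ τ : complexBetti S (2 * 1), IsOfHodgeType 2 S (2 * 1) 2 0 τ → ∃ t : ℂ, τ = t • σ₀)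
    (hσ : IsOfHodgeType 2 S (2 * 1) 2 0 σ) (hσ0 : σ ≠ 0)
    (c : complexBetti S (2 * 1)) (hc : IsOfHodgeType 2 S (2 * 1) 2 0 c) : ∃ t : ℂ, c = t • σ := by
  obtain ⟨s, hs⟩ := hspan σ hσ
  obtain ⟨t, ht⟩ := hspan c hc
  have hs0 : s ≠ 0 := by rintro rfl; exact hσ0 (by rw [hs, zero_smul])
  exact ⟨t * s⁻¹, by rw [ht, hs, smul_smul, inv_mul_cancel_right₀ hs0]⟩

/-- **A marking supplies the Hodge–Riemann inequality `σ̄ ∪ σ ≠ 0`** for every non-zero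
`(2,0)`-class `σ`: with `σ = s • η⁻¹x`, `σ̄ ∪ σ = |s|² (x̄.x) p` (`conjClass_markingSymm`, the cup
product is the lattice form times `p`), and `re (x̄.x) > 0`, `p ≠ 0`.
[cite: Huybrechts2016K3, Ch. 6 Prop. 1.2 (ii) and Ch. 1 Prop. 3.5] -/
theorem cupProduct_conjClass_self_ne_zero_of_marking
    (η : complexBetti S (2 * 1) ≃ₗ[ℂ] (K3Index → ℂ)) {p : complexBetti S (2 * 2)} {x : K3Index → ℂ}
    (hp0 : p ≠ 0)
    (hη : ∀ c : complexBetti S (2 * 1), IsIntegralClass c ↔ ∃ v : K3Index → ℤ, η c = fun i => (v i : ℂ))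
    (hcupf : ∀ a b : complexBetti S (2 * 1),
      cupProduct (rfl : 2 * 1 + 2 * 1 = 2 * 2) a b = k3Form (η a) (η b) • p)
    (hspan : ∀ τ : complexBetti S (2 * 1), IsOfHodgeType 2 S (2 * 1) 2 0 τ →
      ∃ t : ℂ, τ = t • LinearEquiv.symm η x)
    (hxpos : 0 < (k3Form (star x) x).re)
    {σ : complexBetti S (2 * 1)} (hσ : IsOfHodgeType 2 S (2 * 1) 2 0 σ) (hσ0 : σ ≠ 0) :
    cupProduct (rfl : 2 * 1 + 2 * 1 = 2 * 2) (conjClass (Motives.ComplexPoints S) (2 * 1) σ) σ ≠ 0 := by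
  obtain ⟨s, hs⟩ := hspan σ hσ
  have hs0 : s ≠ 0 := by rintro rfl; exact hσ0 (by rw [hs, zero_smul])
  have hxx : k3Form (star x) x ≠ 0 := fun h => by rw [h] at hxpos; simp at hxpos
  rw [hs, conjClass_smul, conjClass_markingSymm η hη, LinearMap.map_smul₂, map_smul,
    hcupf, LinearEquiv.apply_symm_apply, LinearEquiv.apply_symm_apply, smul_smul, smul_smul]
  refine smul_ne_zero ?_ hp0
  exact mul_ne_zero (mul_ne_zero (by simpa using hs0) hs0) hxx

/-- **`Huybrechts_K3_hodgeTypes_H2` from `Huybrechts_K3_marking_exists` and the bigrading of the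
cup product** on K3 surfaces: the marking fact supplies, for every K3 surface, the `(2,0)`-line
(`twoZero_line_of_span`) and the Hodge–Riemann inequality
(`cupProduct_conjClass_self_ne_zero_of_marking`); the rest is
`Huybrechts_K3_hodgeTypes_H2_of_cupPreservesHodgeType`. [cite: Huybrechts2016K3, Ch. 1 Prop. 3.5 and (2.7); Ch. 6 Prop. 1.2] -/
theorem Huybrechts_K3_hodgeTypes_H2_of_marking (hMk : Huybrechts_K3_marking_exists)
    (hcup : ∀ (S : Motives.SchemeOver ℂ), IsK3Surface S → CupPreservesHodgeType 2 S) :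
    Huybrechts_K3_hodgeTypes_H2 := by
  refine Huybrechts_K3_hodgeTypes_H2_of_cupPreservesHodgeType (fun S hS σ hσ hσ0 => ?_) hcup
    (fun S hS σ hσ hσ0 => ?_)
  · obtain ⟨η, p, x, -, ⟨-, -, -, -, -, hspan⟩, -⟩ := hMk S hS
    exact twoZero_line_of_span hspan hσ hσ0
  · obtain ⟨η, p, x, hp0, ⟨-, -, hint, hcupf, -, hspan⟩, ⟨-, hxpos, -⟩⟩ := hMk S hS
    exact cupProduct_conjClass_self_ne_zero_of_marking η hp0 hint hcupf hspan hxpos hσ hσ0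

/-- **`Huybrechts_K3_hodgeTypes_H2` from `Huybrechts_K3_marking_exists` and de Rham's theorem**
(multiplicative form, `exists_deRhamIsoFamily`, on every finite-dimensional complex model space).
[cite: Huybrechts2016K3, Ch. 1 Prop. 3.5 and (2.7); Ch. 6 Prop. 1.2] [cite: WarnerGTM94, Thm. 5.36 / Thm. 5.45] -/
theorem Huybrechts_K3_hodgeTypes_H2_of_marking_of_exists_deRhamIsoFamily
    (hMk : Huybrechts_K3_marking_exists)
    (hdR : ∀ (E : Type) [NormedAddCommGroup E] [NormedSpace ℂ E] [FiniteDimensional ℂ E],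
      exists_deRhamIsoFamily 𝓘(ℝ, E)) :
    Huybrechts_K3_hodgeTypes_H2 :=
  Huybrechts_K3_hodgeTypes_H2_of_marking hMk
    fun _ hS => hS.cupPreservesHodgeType_of_exists_deRhamIsoFamily hdR

end Literature.AlgebraicGeometry.Surfaces

end
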